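import Summits.AtomisticToContinuum.HydrodynamicLimit.Theses.AntiMazurCoboundaries

/-!
# Joint measurability of hard-sphere flows, modified off the good set (helper file 2/7)

`(t, z) ↦ Φ_t z` is jointly measurable after modification off the good set (`measurable_flowMod`): good orbits are
right-continuous (`flow_tendsto_right`, from local finiteness of collision times and continuity of free flight), the
dyadic approximants `Φ_{⌈t2ᵏ⌉/2ᵏ}` are measurable (countably many time slices) and converge pointwise; hence the true
flow is a.e.-measurable on `μ ⊗ ν` whenever `ν` does not charge the bad set (`aemeasurable_uncurry_flow`). The BBGKY
files of the tree carry this as the hypothesis `hΦm`.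
refuter-cdisprove-stmt-AtomisticToContinuum-13985-0 (crux BoltzmannGreenKubo, stmt-13985; infrastructure of the Mazur-floor refutation `Negative/OrthMomentum.lean`, see `Cruxes/BoltzmannGreenKubo/Disproof.lean` §1d–§1h).
-/

noncomputable section

namespace Summit.AtomisticToContinuum.HydrodynamicLimit.Theorems

open MeasureTheory ProbabilityTheory Filter Topology Set
open Literature.Analysis.FluidPDE Literature.MathematicalPhysics.KineticTheory
open Literature.Analysis.UnboundedOperators
open scoped InnerProductSpace

namespace BoltzmannGreenKuboOrthMomentum

section JointMeasurability

variable {N : ℕ} {ε : ℝ}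

/-- Free flight on the torus is continuous in time. [folklore] -/
theorem continuous_freeFlight_time (z : Config N (Fin 3) T3) :
    Continuous fun τ : ℝ => freeFlight (Torus.geometry (Fin 3)) τ z := by
  refine continuous_pi fun i => ?_
  simp only [freeFlight_apply, Torus.geometry_translate]
  refine (continuous_const.add ?_).prodMk continuous_const
  exact Literature.Analysis.FunctionSpaces.Torus.continuous_proj.comp (continuous_id.smul continuous_const)

/-- On a hard-sphere trajectory there is, to the right of every time `t`, a short stretch of free flight
(collision times are locally finite). [folklore] -/
theorem exists_freeFlight_right {γ : ℝ → Config N (Fin 3) T3}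
    (h : IsHardSphereTrajectory (Torus.geometry (Fin 3)) ε N γ) (t : ℝ) :
    ∃ δ > 0, ∀ s ∈ Icc t (t + δ), γ s = freeFlight (Torus.geometry (Fin 3)) (s - t) (γ t) := by
  classical
  have hfin : (collisionTimes (Torus.geometry (Fin 3)) ε γ ∩ Icc t (t + 1)).Finite := h.locFinite t (t + 1)
  set F := hfin.toFinset.filter (fun τ => t < τ) with hF
  by_cases hne : F.Nonempty
  · set m := F.min' hne with hm
    have hmF : m ∈ F := F.min'_mem hne
    have htm : t < m := (Finset.mem_filter.1 hmF).2
    have hm1 : m ≤ t + 1 := by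
      have := (Finset.mem_filter.1 hmF).1
      rw [Set.Finite.mem_toFinset] at this
      exact this.2.2
    refine ⟨(m - t) / 2, by linarith, fun s hs => h.free t s hs.1 fun τ hτ hcoll => ?_⟩
    have hτF : τ ∈ F := by
      rw [hF, Finset.mem_filter, Set.Finite.mem_toFinset]
      exact ⟨⟨hcoll, hτ.1.le, by linarith [hτ.2, hs.2]⟩, hτ.1⟩
    have := F.min'_le τ hτF
    linarith [hτ.2, hs.2]
  · refine ⟨1, one_pos, fun s hs => h.free t s hs.1 fun τ hτ hcoll => hne ⟨τ, ?_⟩⟩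
    rw [hF, Finset.mem_filter, Set.Finite.mem_toFinset]
    exact ⟨⟨hcoll, hτ.1.le, hτ.2.trans hs.2⟩, hτ.1⟩

/-- **Right-continuity of good orbits** along sequences from the right. [folklore] -/
theorem flow_tendsto_right (Φ : HardSphereFlow (Torus.geometry (Fin 3)) ε N)
    {z : Config N (Fin 3) T3} (hz : z ∈ Φ.good) (t : ℝ)
    {u : ℕ → ℝ} (hu : ∀ k, t ≤ u k) (hut : Tendsto u atTop (𝓝 t)) :
    Tendsto (fun k => Φ.flow (u k) z) atTop (𝓝 (Φ.flow t z)) := by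
  obtain ⟨δ, hδ, hfree⟩ := exists_freeFlight_right (Φ.isTrajectory z hz) t
  have hev : (fun k => freeFlight (Torus.geometry (Fin 3)) (u k - t) (Φ.flow t z)) =ᶠ[atTop]
      fun k => Φ.flow (u k) z := by
    have h1 : ∀ᶠ k in atTop, u k < t + δ := hut (Iio_mem_nhds (by linarith))
    filter_upwards [h1] with k hk using (hfree (u k) ⟨hu k, hk.le⟩).symm
  refine Tendsto.congr' hev ?_
  have hc := (continuous_freeFlight_time (N := N) (Φ.flow t z)).tendsto 0
  rw [freeFlight_zero] at hc
  have h0 : Tendsto (fun k => u k - t) atTop (𝓝 0) := by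
    simpa using hut.sub_const t
  exact hc.comp h0

/-- Dyadic approximation from above: `⌈t 2ᵏ⌉ / 2ᵏ`. [folklore] -/
def dyUp (k : ℕ) (t : ℝ) : ℝ := (Int.ceil (t * 2 ^ k) : ℝ) / 2 ^ k

/-- Helper for the Mazur-floor refutation (see the module docstring). [folklore] -/
theorem le_dyUp (k : ℕ) (t : ℝ) : t ≤ dyUp k t := by
  rw [dyUp, le_div_iff₀ (by positivity)]
  exact Int.le_ceil _

/-- Helper for the Mazur-floor refutation (see the module docstring). [folklore] -/
theorem dyUp_le (k : ℕ) (t : ℝ) : dyUp k t ≤ t + 1 / 2 ^ k := by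
  rw [dyUp, div_le_iff₀ (by positivity), add_mul, one_div, inv_mul_cancel₀ (by positivity)]
  exact (Int.ceil_lt_add_one _).le

/-- Helper for the Mazur-floor refutation (see the module docstring). [folklore] -/
theorem tendsto_dyUp (t : ℝ) : Tendsto (fun k => dyUp k t) atTop (𝓝 t) := by
  have h2 : Tendsto (fun k : ℕ => t + 1 / (2 : ℝ) ^ k) atTop (𝓝 t) := by
    have : Tendsto (fun k : ℕ => (1 / 2 : ℝ) ^ k) atTop (𝓝 0) :=
      tendsto_pow_atTop_nhds_zero_of_lt_one (by norm_num) (by norm_num)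
    simpa [one_div, inv_pow] using this.const_add t
  exact tendsto_of_tendsto_of_tendsto_of_le_of_le tendsto_const_nhds h2 (le_dyUp · t) (dyUp_le · t)

open Classical in
/-- The flow MODIFIED off the good set (identity in time there): jointly measurable, and equal to the
flow for every good datum. [folklore] -/
def flowMod (Φ : HardSphereFlow (Torus.geometry (Fin 3)) ε N) (p : ℝ × Config N (Fin 3) T3) :
    Config N (Fin 3) T3 :=
  if p.2 ∈ Φ.good then Φ.flow p.1 p.2 else p.2

/-- Helper for the Mazur-floor refutation (see the module docstring). [folklore] -/
theorem flowMod_of_mem (Φ : HardSphereFlow (Torus.geometry (Fin 3)) ε N) {t : ℝ}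
    {z : Config N (Fin 3) T3} (hz : z ∈ Φ.good) : flowMod Φ (t, z) = Φ.flow t z := by
  simp [flowMod, hz]

open Classical in
/-- The dyadic approximants of the modified flow. [folklore] -/
def flowModK (Φ : HardSphereFlow (Torus.geometry (Fin 3)) ε N) (k : ℕ)
    (p : ℝ × Config N (Fin 3) T3) : Config N (Fin 3) T3 :=
  if p.2 ∈ Φ.good then Φ.flow (dyUp k p.1) p.2 else p.2

open Classical in
/-- Each dyadic approximant is jointly measurable (countably many time slices). [folklore] -/
theorem measurable_flowModK (Φ : HardSphereFlow (Torus.geometry (Fin 3)) ε N) (k : ℕ) :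
    Measurable (flowModK Φ k) := by
  have h1 : Measurable fun q : ℤ × Config N (Fin 3) T3 =>
      if q.2 ∈ Φ.good then Φ.flow ((q.1 : ℝ) / 2 ^ k) q.2 else q.2 := by
    refine measurable_from_prod_countable_right fun m => ?_
    show Measurable fun y : Config N (Fin 3) T3 =>
      if y ∈ Φ.good then Φ.flow ((m : ℝ) / 2 ^ k) y else y
    exact Measurable.ite Φ.measurableSet_good (Φ.measurable_flow _) measurable_id
  have h2 : Measurable fun p : ℝ × Config N (Fin 3) T3 => (Int.ceil (p.1 * 2 ^ k), p.2) :=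
    (Int.measurable_ceil.comp (measurable_fst.mul_const _)).prodMk measurable_snd
  exact h1.comp h2

/-- The approximants converge pointwise to the modified flow (right-continuity of good orbits). [folklore] -/
theorem tendsto_flowModK (Φ : HardSphereFlow (Torus.geometry (Fin 3)) ε N)
    (p : ℝ × Config N (Fin 3) T3) :
    Tendsto (fun k => flowModK Φ k p) atTop (𝓝 (flowMod Φ p)) := by
  by_cases hp : p.2 ∈ Φ.good
  · simp only [flowModK, flowMod, hp, if_true]
    exact flow_tendsto_right Φ hp p.1 (fun k => le_dyUp k p.1) (tendsto_dyUp p.1)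
  · simp only [flowModK, flowMod, hp, if_false]
    exact tendsto_const_nhds

/-- **Joint measurability of the (modified) hard-sphere flow** `(t, z) ↦ Φ_t z` (componentwise: positions in
`𝕋³`, velocities in `ℝ³`, both metrizable Borel; pointwise limits of measurable maps). [folklore] -/
theorem measurable_flowMod (Φ : HardSphereFlow (Torus.geometry (Fin 3)) ε N) :
    Measurable (flowMod Φ) := by
  refine measurable_pi_lambda _ fun i => ?_
  have hpos : Measurable fun p : ℝ × Config N (Fin 3) T3 => (flowMod Φ p i).1 := by
    refine measurable_of_tendsto_metrizable (f := fun k p => (flowModK Φ k p i).1)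
      (fun k => ((measurable_pi_apply i).comp (measurable_flowModK Φ k)).fst) ?_
    rw [tendsto_pi_nhds]
    intro p
    exact (continuous_fst.tendsto _).comp
      (((continuous_apply i).tendsto _).comp (tendsto_flowModK Φ p))
  have hvel : Measurable fun p : ℝ × Config N (Fin 3) T3 => (flowMod Φ p i).2 := by
    refine measurable_of_tendsto_metrizable (f := fun k p => (flowModK Φ k p i).2)
      (fun k => ((measurable_pi_apply i).comp (measurable_flowModK Φ k)).snd) ?_
    rw [tendsto_pi_nhds]
    intro p
    exact (continuous_snd.tendsto _).comp
      (((continuous_apply i).tendsto _).comp (tendsto_flowModK Φ p))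
  exact hpos.prodMk hvel

/-- **A.e.-measurability of the true flow on a product** `μ ⊗ ν` whenever `ν` does not charge the bad set
(e.g. `ν = G_N ≪ Liouville`). [folklore] -/
theorem aemeasurable_uncurry_flow (Φ : HardSphereFlow (Torus.geometry (Fin 3)) ε N)
    (μ : Measure ℝ) [SFinite μ] (ν : Measure (Config N (Fin 3) T3)) [SFinite ν] (hν : ν Φ.goodᶜ = 0) :
    AEMeasurable (fun p : ℝ × Config N (Fin 3) T3 => Φ.flow p.1 p.2) (μ.prod ν) := by
  refine ⟨flowMod Φ, measurable_flowMod Φ, ?_⟩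
  have hnull : (μ.prod ν) (Set.univ ×ˢ Φ.goodᶜ) = 0 := by
    rw [Measure.prod_prod, hν, mul_zero]
  have hae : ∀ᵐ p ∂(μ.prod ν), p.2 ∈ Φ.good := by
    rw [ae_iff]
    refine measure_mono_null (fun p hp => ?_) hnull
    exact ⟨Set.mem_univ _, hp⟩
  filter_upwards [hae] with p hp
  rw [show p = (p.1, p.2) from rfl, flowMod_of_mem Φ hp]

end JointMeasurability


end BoltzmannGreenKuboOrthMomentum

end Summit.AtomisticToContinuum.HydrodynamicLimit.Theorems

end
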